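import Summits.ResolutionOfSingularities.ResolutionOfSingularities.Theorems.EquisingularLiftEquisingularLiftNatEquinodalNoseRegularFibre
import HarnessLib

/-!
# [OURS · L1 W4.5(b) · EL♮(3) · NU7 §A2 «Σ1 SMOOTHING LEMMA», part 1] THE SMOOTHING FAMILY `𝓦_Ĝ = (L̃, σ̃ Ĝ)~ ⊂ ℙ³_O`:
# REDUCED TRACE `𝓘⟨Z⟩` AND `O`-FLATNESS FOR AN ARBITRARY LIFT `Ĝ` OF `g|_Π`

res-L1-w45b-stub-2 g19 (STUB WORKER 2), brick NAMED by the desk (RULING R70 (iii), cell bus 2026-08-29T05:37:22Z, on res-L1-w45b-idea-2's pointer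
NU7 §A2): customer-INDEPENDENT banked support — it changes no door text and deals no width (F4 intact).  OURS; NOT a statement of any manuscript
([Hironaka2017] is a candidate under adjudication — nothing of it is asserted here); AI-written, weaker than expert review.  No `sorry`; standard
axioms; DEF-FREE.  `--supports stmt-ResolutionOfSingularities-20148 --as helper`, counted 0.  EL♮(3) is NOT proved; resolution of singularities in
positive characteristic is NOT proved.

WHAT.  At the INITIAL stage `(ℙ³_O, 𝟙, Proj φ)` of the chain (currency of ✓ `jinit_rPlus₀_of_noseDatum` / ✓ `coreS_of_cores`): for a planar trace
`Z = V₊(ℓ) ∩ V₊(g) ⊂ ℙ³_k` with `g|_Π` SQUAREFREE (no node data, no `EqCertAt₀`), the lifted hyperplane data `(L̃, B̃, Ñ)` of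
✓ `HyperplaneLift.exists_hyperplane_lift`, and ANY homogeneous lift `Ĝ ∈ O[y₀,y₁,y₂]_e` of `g|_Π` (`θ Ĝ = g|_Π`), the complete-intersection model
`𝓦_Ĝ := (L̃, σ̃ Ĝ)~` has REDUCED TRACE `𝓦_Ĝ · 𝒪_{ℙ³_k} = 𝓘⟨Z⟩` and `V(𝓦_Ĝ) → Spec O` is FLAT — the two `c`-independent clauses of the Σ1 smoothing lemma
(part 3 `planar_trace_smoothing` chooses `Ĝ = G̃ + c·ϖ·M̃`).  This is ✓ W5a `nose_trace_and_flat` (res-L1-w45b-stub-2 g17, after res-L1-w45b-nose-w1's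
✓ `NoseModel.flat_nose` / ✓ `NoseModel.comap_eq_vanishingIdeal_of_isRadical`) with the node binders of `cores` DELETED: its proof never used them.
References (method / index only): R. Hartshorne, *Algebraic Geometry* (1977), II Prop. 5.9, III Prop. 9.7.
-/

set_option linter.dupNamespace false -- mandated namespace `Summit.<Summit>.<Problem>` of this single-conjunct summit
set_option linter.overlappingInstances false -- signatures carry `[IsDomain O] [IsDiscreteValuationRing O]` (as ✓ coreS_of_cores)

noncomputable section

open CategoryTheory CategoryTheory.Limits AlgebraicGeometry TopologicalSpace Topology IsLocalRing
open MvPolynomial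
open Literature.AlgebraicGeometry.Resolution
open AlgebraicGeometry.Scheme.IdealSheafData
open Summit.ResolutionOfSingularities.ResolutionOfSingularities.Cruxes.EquisingularLift.StrataSplit

namespace Summit.ResolutionOfSingularities.ResolutionOfSingularities.Cruxes.EquisingularLiftNat.Sections.Equinodal

open Summit.ResolutionOfSingularities.ResolutionOfSingularities.Cruxes.EquisingularLiftNat.Sections

set_option maxHeartbeats 800000 in -- long binder list
/-- **The smoothing family's `c`-independent clauses: reduced trace and flatness.**  For the lifted hyperplane data `(L̃, B̃, Ñ)` and ANY
homogeneous lift `Ĝ` of the squarefree `g|_Π`, the model `𝓦_Ĝ = (L̃, σ̃ Ĝ)~ ⊂ ℙ³_O` has `𝓦_Ĝ · 𝒪_{ℙ³_k} = 𝓘⟨Z⟩` and `V(𝓦_Ĝ) → Spec O` flat.  See the module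
docstring (✓ W5a `nose_trace_and_flat` minus the node binders). [cite: Hartshorne1977, II Prop. 5.9, III Prop. 9.7] [OURS · NU7 §A2 part 1] -/
theorem smoothing_trace_and_flat (k : Type) [Field k]
    (O : Type) [CommRing O] [IsDomain O] [IsDiscreteValuationRing O] (θ : O →+* k) (hθ : Function.Surjective θ) :
    letI := MvPolynomial.gradedAlgebra (σ := Fin (3 + 1)) (R := O); letI := MvPolynomial.gradedAlgebra (σ := Fin (3 + 1)) (R := k);
    ∀ (φ : MvPolynomial.homogeneousSubmodule (Fin (3 + 1)) O →+*ᵍ MvPolynomial.homogeneousSubmodule (Fin (3 + 1)) k)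
      (hφ' : HomogeneousIdeal.irrelevant (MvPolynomial.homogeneousSubmodule (Fin (3 + 1)) k) ≤ (HomogeneousIdeal.irrelevant (MvPolynomial.homogeneousSubmodule (Fin (3 + 1)) O)).map φ), (∀ s, φ s = MvPolynomial.map θ s) →
    -- the door's `ℓ`, `Z` and the REDUCED PLANAR EQUATION (first block of `EqCertAt₀`, no node data)
    ∀ (ℓ : MvPolynomial (Fin (3 + 1)) k) (Z : Set (Literature.AlgebraicGeometry.Motives.projectiveSpace 3 k).left) (hZ : IsClosed Z) (e : ℕ) (g : MvPolynomial (Fin (3 + 1)) k)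
      (B : Fin (3 + 1) → Fin 3 → k) (r : Fin 3 → Fin (3 + 1)),
      g.IsHomogeneous e → Squarefree (restrictToHyperplane B g) →
      Z = {y : (Literature.AlgebraicGeometry.Motives.projectiveSpace 3 k).left | ℓ ∈ (y : ProjectiveSpectrum (MvPolynomial.homogeneousSubmodule (Fin (3 + 1)) k)).asHomogeneousIdeal ∧ g ∈ (y : ProjectiveSpectrum (MvPolynomial.homogeneousSubmodule (Fin (3 + 1)) k)).asHomogeneousIdeal} →
    -- the LIFTED HYPERPLANE data (✓ `HyperplaneLift.exists_hyperplane_lift`)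
    ∀ (Bt : Fin (3 + 1) → Fin 3 → O) (ct : Fin (3 + 1) → O) (Nt : Fin 3 → Fin 3 → O),
      (∀ a' j, θ (Bt a' j) = B a' j) →
      MvPolynomial.aeval (fun a' : Fin (3 + 1) => ∑ j : Fin 3, MvPolynomial.C (Bt a' j) * MvPolynomial.X j) (∑ a, MvPolynomial.C (ct a) * MvPolynomial.X a : MvPolynomial (Fin (3 + 1)) O) = 0 →
      (∀ G : MvPolynomial (Fin 3) O, MvPolynomial.aeval (fun a' : Fin (3 + 1) => ∑ j : Fin 3, MvPolynomial.C (Bt a' j) * MvPolynomial.X j)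
        (MvPolynomial.aeval (fun i : Fin 3 => ∑ j : Fin 3, MvPolynomial.C (Nt i j) * MvPolynomial.X (r j)) G) = G) →
      (∀ f : MvPolynomial (Fin (3 + 1)) O, MvPolynomial.aeval (fun a' : Fin (3 + 1) => ∑ j : Fin 3, MvPolynomial.C (Bt a' j) * MvPolynomial.X j) f = 0 → (∑ a, MvPolynomial.C (ct a) * MvPolynomial.X a : MvPolynomial (Fin (3 + 1)) O) ∣ f) →
      {y : (Literature.AlgebraicGeometry.Motives.projectiveSpace 3 k).left | ℓ ∈ (y : ProjectiveSpectrum (MvPolynomial.homogeneousSubmodule (Fin (3 + 1)) k)).asHomogeneousIdeal} = {y : (Literature.AlgebraicGeometry.Motives.projectiveSpace 3 k).left | (∑ a, MvPolynomial.C (θ (ct a)) * MvPolynomial.X a : MvPolynomial (Fin (3 + 1)) k) ∈ (y : ProjectiveSpectrum (MvPolynomial.homogeneousSubmodule (Fin (3 + 1)) k)).asHomogeneousIdeal} →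
    -- ANY homogeneous lift `Ĝ` of `g|_Π`
    ∀ (Gt : MvPolynomial (Fin 3) O), Gt.IsHomogeneous e → MvPolynomial.map θ Gt = restrictToHyperplane B g →
    ∀ (hF : ∀ l, (![(∑ a, MvPolynomial.C (ct a) * MvPolynomial.X a : MvPolynomial (Fin (3 + 1)) O), (MvPolynomial.aeval (fun i : Fin 3 => ∑ j : Fin 3, MvPolynomial.C (Nt i j) * MvPolynomial.X (r j)) Gt : MvPolynomial (Fin (3 + 1)) O)] : Fin 2 → MvPolynomial (Fin (3 + 1)) O) l ∈
        MvPolynomial.homogeneousSubmodule (Fin (3 + 1)) O ((![1, e] : Fin 2 → ℕ) l)),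
      (projIdealSheaf (MvPolynomial.homogeneousSubmodule (Fin (3 + 1)) O) ⟨Ideal.span (Set.range ![(∑ a, MvPolynomial.C (ct a) * MvPolynomial.X a : MvPolynomial (Fin (3 + 1)) O), (MvPolynomial.aeval (fun i : Fin 3 => ∑ j : Fin 3, MvPolynomial.C (Nt i j) * MvPolynomial.X (r j)) Gt : MvPolynomial (Fin (3 + 1)) O)]),
          isHomogeneous_span_of_forall_mem _ _ _ hF⟩).comap (AlgebraicGeometry.Proj.map φ hφ') = vanishingIdeal (⟨Z, hZ⟩ : Closeds _) ∧
      AlgebraicGeometry.Flat ((projIdealSheaf (MvPolynomial.homogeneousSubmodule (Fin (3 + 1)) O) ⟨Ideal.span (Set.range ![(∑ a, MvPolynomial.C (ct a) * MvPolynomial.X a : MvPolynomial (Fin (3 + 1)) O), (MvPolynomial.aeval (fun i : Fin 3 => ∑ j : Fin 3, MvPolynomial.C (Nt i j) * MvPolynomial.X (r j)) Gt : MvPolynomial (Fin (3 + 1)) O)]),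
          isHomogeneous_span_of_forall_mem _ _ _ hF⟩).subschemeι ≫
        (AlgebraicGeometry.Proj.toSpecZero (MvPolynomial.homogeneousSubmodule (Fin (3 + 1)) O) ≫ AlgebraicGeometry.Spec.map (CommRingCat.ofHom (algebraMap O (MvPolynomial.homogeneousSubmodule (Fin (3 + 1)) O 0))))) := by
  classical
  letI := MvPolynomial.gradedAlgebra (σ := Fin (3 + 1)) (R := O)
  letI := MvPolynomial.gradedAlgebra (σ := Fin (3 + 1)) (R := k)
  intro φ hφ' hφ ℓ Z hZ e g B r hg hsq hZeq Bt ct Nt hBt hψt hsect hkert hVlin Gt hGt hGtg hF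
  -- adapted from ✓ W5a `nose_trace_and_flat` (itself from ✓ `coreS_of_cores` / ✓ `noseDatum_initial_of_sections`)
  let ψk : MvPolynomial (Fin (3 + 1)) k →ₐ[k] MvPolynomial (Fin 3) k := MvPolynomial.aeval fun a' : Fin (3 + 1) => ∑ j : Fin 3, C (B a' j) * X j
  let σk : MvPolynomial (Fin 3) k → MvPolynomial (Fin (3 + 1)) k := fun G => aeval (fun i : Fin 3 => ∑ j : Fin 3, C (θ (Nt i j)) * X (r j)) G
  have hψσk : ∀ G, ψk (σk G) = G := by
    intro G
    obtain ⟨G', rfl⟩ := MvPolynomial.map_surjective θ hθ G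
    change MvPolynomial.aeval _ (aeval _ (MvPolynomial.map θ G')) = _
    rw [← map_aeval_sect θ Nt r G', ← HyperplaneLift.map_aeval_linear θ Bt B hBt, hsect]
  have hψk : ψk (∑ a', C (θ (ct a')) * X a' : MvPolynomial (Fin (3 + 1)) k) = 0 := by
    change MvPolynomial.aeval _ _ = 0
    rw [← HyperplaneLift.map_sum_C_mul_X θ ct, ← HyperplaneLift.map_aeval_linear θ Bt B hBt, hψt, map_zero]
  have hkerk : ∀ f₀ : MvPolynomial (Fin (3 + 1)) k, ψk f₀ = 0 → (∑ a', C (θ (ct a')) * X a' : MvPolynomial (Fin (3 + 1)) k) ∣ f₀ := by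
    intro f₀ hf₀
    obtain ⟨f', rfl⟩ := MvPolynomial.map_surjective θ hθ f₀
    let ψr : MvPolynomial (Fin (3 + 1)) O →+* MvPolynomial (Fin 3) O :=
      (MvPolynomial.aeval fun a' : Fin (3 + 1) => ∑ j : Fin 3, C (Bt a' j) * X j).toRingHom
    have hsectr : ∀ G, ψr (aeval (fun i : Fin 3 => ∑ j : Fin 3, C (Nt i j) * X (r j)) G) = G := fun G => hsect G
    have hkertr : ∀ f₁, ψr f₁ = 0 → (∑ a', C (ct a') * X a' : MvPolynomial (Fin (3 + 1)) O) ∣ f₁ := fun f₁ hf₁ => hkert f₁ hf₁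
    obtain ⟨m', hm'⟩ := HyperplaneAlg.dvd_sub_section ψr (fun G => aeval (fun i : Fin 3 => ∑ j : Fin 3, C (Nt i j) * X (r j)) G)
      (∑ a', C (ct a') * X a' : MvPolynomial (Fin (3 + 1)) O) hsectr hkertr f'
    have hred : MvPolynomial.map θ (ψr f') = 0 := by
      change MvPolynomial.map θ ((MvPolynomial.aeval fun a' : Fin (3 + 1) => ∑ j : Fin 3, C (Bt a' j) * X j) f') = 0
      rw [HyperplaneLift.map_aeval_linear θ Bt B hBt]; exact hf₀
    have hf' : f' = (∑ a', C (ct a') * X a') * m' + aeval (fun i : Fin 3 => ∑ j : Fin 3, C (Nt i j) * X (r j)) (ψr f') := by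
      rw [← hm']; ring
    refine ⟨MvPolynomial.map θ m', ?_⟩
    rw [hf', map_add, map_mul, HyperplaneLift.map_sum_C_mul_X, map_aeval_sect, hred, map_zero, add_zero]
  let f : Fin 2 → MvPolynomial (Fin (3 + 1)) k := ![∑ a', C (θ (ct a')) * X a', σk (restrictToHyperplane B g)]
  have hφX : ∀ i : Fin (3 + 1), φ (X i) = X i := fun i => by rw [hφ, map_X]
  have hφF : ∀ l, φ ((![(∑ a', C (ct a') * X a' : MvPolynomial (Fin (3 + 1)) O),
      aeval (fun i' : Fin 3 => ∑ j : Fin 3, C (Nt i' j) * X (r j)) Gt] : Fin 2 → MvPolynomial (Fin (3 + 1)) O) l) = f l := by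
    intro l; fin_cases l
    · change φ (∑ a', C (ct a') * X a') = ∑ a', C (θ (ct a')) * X a'
      rw [hφ, HyperplaneLift.map_sum_C_mul_X]
    · change φ (aeval (fun i' : Fin 3 => ∑ j : Fin 3, C (Nt i' j) * X (r j)) Gt) = σk (restrictToHyperplane B g)
      rw [hφ, map_aeval_sect, hGtg]
  have hhe : (restrictToHyperplane B g).IsHomogeneous e := isHomogeneous_restrictToHyperplane B g hg
  have hf : ∀ l, f l ∈ homogeneousSubmodule (Fin (3 + 1)) k ((![1, e] : Fin 2 → ℕ) l) := by
    intro l; fin_cases l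
    · exact HyperplaneAlg.isHomogeneous_sum_C_mul_X (fun a' => θ (ct a')) id
    · exact HyperplaneAlg.isHomogeneous_aeval_linear _ (fun i => HyperplaneAlg.isHomogeneous_sum_C_mul_X _ _) _ hhe
  have hrad : (Ideal.span (Set.range f)).IsRadical :=
    NoseModel.isRadical_span_range_pair ψk.toRingHom σk _ hψk hψσk hkerk (restrictToHyperplane B g) hsq
  have hZf : Z = {y : Proj (homogeneousSubmodule (Fin (3 + 1)) k) | ∀ l, f l ∈ y.asHomogeneousIdeal} :=
    hZeq.trans (NoseModel.setOf_pair_eq ψk.toRingHom σk _ hψσk hkerk ℓ g hVlin)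
  have hW2 := NoseModel.comap_eq_vanishingIdeal_of_isRadical φ hφ' hφX (![(∑ a', C (ct a') * X a' : MvPolynomial (Fin (3 + 1)) O),
    aeval (fun i' : Fin 3 => ∑ j : Fin 3, C (Nt i' j) * X (r j)) Gt] : Fin 2 → MvPolynomial (Fin (3 + 1)) O) f (![1, e] : Fin 2 → ℕ)
    hF hf hφF hrad Z hZ hZf
  -- flatness
  have hh0 : restrictToHyperplane B g ≠ 0 := hsq.ne_zero
  have hGt0 : MvPolynomial.map θ Gt ≠ 0 := by rw [hGtg]; exact hh0
  have hW3 := NoseModel.flat_nose O θ hθ (MvPolynomial.aeval fun a' : Fin (3 + 1) => ∑ j : Fin 3, C (Bt a' j) * X j)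
    (fun G => aeval (fun i : Fin 3 => ∑ j : Fin 3, C (Nt i j) * X (r j)) G) (∑ a', C (ct a') * X a') hψt hsect hkert Gt hGt0 e hF
  exact ⟨hW2, hW3⟩

end Summit.ResolutionOfSingularities.ResolutionOfSingularities.Cruxes.EquisingularLiftNat.Sections.Equinodal

end
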